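import Summits.Ventures.WeilGRH.UniformConductorFloorPrincipalMod281Log12Data
import Summits.Ventures.WeilGRH.TwistedGramCellCheckColsE
import HarnessLib

/-!
# The PRINCIPAL character mod 281 at `a = (log 12)/2` — EVEN cell row `6`, columns `0…7` (file G1 of 2 for this row: 4 kernel chunks of width 2)

Cell `rh-explicit`, WEIL TRACK — GRH ARM (weil-grh-1 gen10; weil-grh-2 gen13's door-E pipeline at the `S = 2^80`, 256-MODE table `Log12Table.tab256`
(`UniformConductorFloorLog12TableHi.lean`): with the 128-mode table the door is NOT positive definite for `χ₀` mod 281 (best even `λ_float = −0.0050` at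
`14 × 127`; the far-block truncation loss ≈ `0.02` exceeds the margin `0.014` of `281` over the 32-mode Galerkin bottom `277.05`), with far block `B₃ = 255`
it is: even `λ = +0.00125` at `14 × 255`, `θ = 2/64` (`14 × 200` still fails).  At this width one even ROW exceeds the kernel memory guard, so the even rows
are checked by column HALVES (`TwistedGramCellCheckColsE.lean`) (width 2, ≈ 25–30 s each) in two or three files per row (35 files: the farm's kernel memory guard is cumulative over a file and the chunk cost grows with the row index) and re-glued; the mathematics and the door are unchanged).
Kernel facts only (`checkCellECols` chunks glued into `checkCellERows … i 1` by `checkCellERows_of_cols`); RH/GRH-free; standard axioms.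
References: H. Yoshida (1992) §§5–7 [Yoshida1992HermitianForms]; R. E. Moore (1966) Ch. 3 [Moore1966]; N. J. Higham (2002) [Higham2002ASNA].
-/

namespace Summit.Ventures.WeilGRH.PrincipalMod281Log12
open Literature.NumberTheory.LFunctions Literature.NumberTheory.LFunctions.Yoshida1992 Encl
open Literature.Analysis.ValidatedNumerics.NumericsMP Literature.Analysis.SpecialFunctions
open Summit.Ventures.WeilGRH.Log12Table
open Summit.Ventures.WeilGRH.TwistedEncl
open scoped Real ComplexConjugate ArithmeticFunction.vonMangoldt

/-- even cell row `6`, columns `0…1`, principal mod 281 at `(log 12)/2`. [cite: Moore1966, Ch. 3 (interval arithmetic: inclusion property)] -/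
theorem tE281r6c0 : checkCellECols (2 ^ 80) C εs281 LQ281 tab256 dE281 60 23 DE281 6 0 2 = true := by
  set_option maxHeartbeats 0 in
  set_option maxRecDepth 200000 in decide +kernel
/-- even cell row `6`, columns `2…3`, principal mod 281 at `(log 12)/2`. [cite: Moore1966, Ch. 3 (interval arithmetic: inclusion property)] -/
theorem tE281r6c1 : checkCellECols (2 ^ 80) C εs281 LQ281 tab256 dE281 60 23 DE281 6 2 2 = true := by
  set_option maxHeartbeats 0 in
  set_option maxRecDepth 200000 in decide +kernel
/-- even cell row `6`, columns `4…5`, principal mod 281 at `(log 12)/2`. [cite: Moore1966, Ch. 3 (interval arithmetic: inclusion property)] -/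
theorem tE281r6c2 : checkCellECols (2 ^ 80) C εs281 LQ281 tab256 dE281 60 23 DE281 6 4 2 = true := by
  set_option maxHeartbeats 0 in
  set_option maxRecDepth 200000 in decide +kernel
/-- even cell row `6`, columns `6…7`, principal mod 281 at `(log 12)/2`. [cite: Moore1966, Ch. 3 (interval arithmetic: inclusion property)] -/
theorem tE281r6c3 : checkCellECols (2 ^ 80) C εs281 LQ281 tab256 dE281 60 23 DE281 6 6 2 = true := by
  set_option maxHeartbeats 0 in
  set_option maxRecDepth 200000 in decide +kernel

end Summit.Ventures.WeilGRH.PrincipalMod281Log12
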